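import Mathlib
import Summits.ValiantsHypothesis.ValiantsHypothesis.Theorems.ElementaryWordLengthWordLengthQPStubKappaTwoStructureAux
import Summits.ValiantsHypothesis.ValiantsHypothesis.Theorems.ElementaryWordLengthWordLengthQPStubKappaTwoStructureAuxB
import Summits.ValiantsHypothesis.ValiantsHypothesis.Theorems.ElementaryWordLengthWordLengthQPStubKappaTwoStructureAuxC
import Summits.ValiantsHypothesis.ValiantsHypothesis.Theorems.ElementaryWordLengthWordLengthQPStubKappaTwoStructureAuxD
import Summits.ValiantsHypothesis.ValiantsHypothesis.Theorems.ElementaryWordLengthWordLengthQPStubKappaTwoStructureAuxE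
import Summits.ValiantsHypothesis.ValiantsHypothesis.Theorems.ElementaryWordLengthWordLengthQPStubKappaTwoStructureAuxF
import Summits.ValiantsHypothesis.ValiantsHypothesis.Theorems.ElementaryWordLengthWordLengthQPStubKappaTwoStructureAuxG
import Summits.ValiantsHypothesis.ValiantsHypothesis.Theorems.ElementaryWordLengthWordLengthQPStubKappaTwoStructureAuxH

/-!
# Crux `WordLengthQP` (stmt-ValiantsHypothesis-6623), line `positive-monoid-exits` —
helpers for stub `stub_kappaTwoStructure`, part I: triangular skeletons and CONFINEMENT for the
`(y₁, y₂)` and `(x₂, x₁)` families.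

* lower / upper unitriangular real matrices (`LOWU` / `UPU`, spelled out) are closed under
  products and contain the relevant skeleton letters;
* `k2_conf_III`: skeleton loop `P̄₀ E₁₀(a) Q̄ E₂₁(b) P̄₂ = 1` ⇒ no constant positive `x₁`, `x₂`;
* `k2_conf_IV`: skeleton loop `P̄₀ E₁₂(a) Q̄ E₀₁(b) P̄₂ = 1` ⇒ no constant positive `y₁`, `y₂`.
Both by the same rotation as `k2_conf_I`, reading the two untouched adjacent entries.
-/

set_option linter.dupNamespace false

noncomputable section

namespace Summit.ValiantsHypothesis.ValiantsHypothesis.Cruxes.WordLengthQP.PositiveMonoidExits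

open MvPolynomial

/-- `LOWU` (lower unitriangular) is closed under products. [folklore] -/
theorem k2_lowu_mul (G H : Matrix (Fin 3) (Fin 3) ℝ)
    (hG : G 0 1 = 0 ∧ G 0 2 = 0 ∧ G 1 2 = 0 ∧ G 0 0 = 1 ∧ G 1 1 = 1 ∧ G 2 2 = 1)
    (hH : H 0 1 = 0 ∧ H 0 2 = 0 ∧ H 1 2 = 0 ∧ H 0 0 = 1 ∧ H 1 1 = 1 ∧ H 2 2 = 1) :
    (G * H) 0 1 = 0 ∧ (G * H) 0 2 = 0 ∧ (G * H) 1 2 = 0 ∧ (G * H) 0 0 = 1 ∧ (G * H) 1 1 = 1 ∧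
      (G * H) 2 2 = 1 := by
  obtain ⟨g01, g02, g12, g00, g11, g22⟩ := hG
  obtain ⟨h01, h02, h12, h00, h11, h22⟩ := hH
  simp [Matrix.mul_apply, Fin.sum_univ_three, g01, g02, g12, g00, g11, g22, h01, h02, h12, h00, h11, h22]

/-- Products of lists of `LOWU` matrices are `LOWU`. [folklore] -/
theorem k2_lowu_prod (Ts : List (Matrix (Fin 3) (Fin 3) ℝ))
    (h : ∀ G ∈ Ts, G 0 1 = 0 ∧ G 0 2 = 0 ∧ G 1 2 = 0 ∧ G 0 0 = 1 ∧ G 1 1 = 1 ∧ G 2 2 = 1) :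
    Ts.prod 0 1 = 0 ∧ Ts.prod 0 2 = 0 ∧ Ts.prod 1 2 = 0 ∧ Ts.prod 0 0 = 1 ∧ Ts.prod 1 1 = 1 ∧
      Ts.prod 2 2 = 1 := by
  induction Ts with
  | nil => simp
  | cons T Ts ih =>
    rw [List.prod_cons]
    exact k2_lowu_mul T Ts.prod (h T (by simp)) (ih fun G hG => h G (by simp [hG]))

/-- `E₁₀(t)`, `E₂₁(t)`, `E₂₀(t)` are `LOWU`. [folklore] -/
theorem k2_lowu_letter (i j : Fin 3) (hij : j < i) (t : ℝ) :
    (Matrix.transvection i j t) 0 1 = 0 ∧ (Matrix.transvection i j t) 0 2 = 0 ∧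
      (Matrix.transvection i j t) 1 2 = 0 ∧ (Matrix.transvection i j t) 0 0 = 1 ∧
      (Matrix.transvection i j t) 1 1 = 1 ∧ (Matrix.transvection i j t) 2 2 = 1 := by
  fin_cases i <;> fin_cases j <;> simp at hij <;> simp [Matrix.transvection]

/-- `UPU` (upper unitriangular) is closed under products. [folklore] -/
theorem k2_upu_mul (G H : Matrix (Fin 3) (Fin 3) ℝ)
    (hG : G 1 0 = 0 ∧ G 2 0 = 0 ∧ G 2 1 = 0 ∧ G 0 0 = 1 ∧ G 1 1 = 1 ∧ G 2 2 = 1)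
    (hH : H 1 0 = 0 ∧ H 2 0 = 0 ∧ H 2 1 = 0 ∧ H 0 0 = 1 ∧ H 1 1 = 1 ∧ H 2 2 = 1) :
    (G * H) 1 0 = 0 ∧ (G * H) 2 0 = 0 ∧ (G * H) 2 1 = 0 ∧ (G * H) 0 0 = 1 ∧ (G * H) 1 1 = 1 ∧
      (G * H) 2 2 = 1 := by
  obtain ⟨g10, g20, g21, g00, g11, g22⟩ := hG
  obtain ⟨h10, h20, h21, h00, h11, h22⟩ := hH
  simp [Matrix.mul_apply, Fin.sum_univ_three, g10, g20, g21, g00, g11, g22, h10, h20, h21, h00, h11, h22]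

/-- Products of lists of `UPU` matrices are `UPU`. [folklore] -/
theorem k2_upu_prod (Ts : List (Matrix (Fin 3) (Fin 3) ℝ))
    (h : ∀ G ∈ Ts, G 1 0 = 0 ∧ G 2 0 = 0 ∧ G 2 1 = 0 ∧ G 0 0 = 1 ∧ G 1 1 = 1 ∧ G 2 2 = 1) :
    Ts.prod 1 0 = 0 ∧ Ts.prod 2 0 = 0 ∧ Ts.prod 2 1 = 0 ∧ Ts.prod 0 0 = 1 ∧ Ts.prod 1 1 = 1 ∧
      Ts.prod 2 2 = 1 := by
  induction Ts with
  | nil => simp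
  | cons T Ts ih =>
    rw [List.prod_cons]
    exact k2_upu_mul T Ts.prod (h T (by simp)) (ih fun G hG => h G (by simp [hG]))

/-- `E₀₁(t)`, `E₁₂(t)`, `E₀₂(t)` are `UPU`. [folklore] -/
theorem k2_upu_letter (i j : Fin 3) (hij : i < j) (t : ℝ) :
    (Matrix.transvection i j t) 1 0 = 0 ∧ (Matrix.transvection i j t) 2 0 = 0 ∧
      (Matrix.transvection i j t) 2 1 = 0 ∧ (Matrix.transvection i j t) 0 0 = 1 ∧
      (Matrix.transvection i j t) 1 1 = 1 ∧ (Matrix.transvection i j t) 2 2 = 1 := by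
  fin_cases i <;> fin_cases j <;> simp at hij <;> simp [Matrix.transvection]

/-- Skeleton letters of a tame letter without constant positive `x₁`, `x₂` are `LOWU`. [folklore] -/
theorem k2_lowu_skel {σ : Type} (l : Fin 3 × Fin 3 × ℝ × Option σ) (h : ((0 < Prod.fst (Prod.snd (Prod.snd l)) ∧ (Fin.val (Prod.fst l) + 1 = Fin.val (Prod.fst (Prod.snd l)) ∨ Fin.val (Prod.fst (Prod.snd l)) + 1 = Fin.val (Prod.fst l))) ∨ Prod.fst (Prod.snd (Prod.snd l)) = 0))
    (hx1 : l.2.2.2 = none → l.1 = 0 → l.2.1 = 1 → l.2.2.1 = 0)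
    (hx2 : l.2.2.2 = none → l.1 = 1 → l.2.1 = 2 → l.2.2.1 = 0) :
    (Matrix.transvection (Prod.fst l) (Prod.fst (Prod.snd l)) (Option.elim (Prod.snd (Prod.snd (Prod.snd l))) (Prod.fst (Prod.snd (Prod.snd l))) (fun _ => (0 : ℝ))) : Matrix (Fin 3) (Fin 3) ℝ) 0 1 = 0 ∧ (Matrix.transvection (Prod.fst l) (Prod.fst (Prod.snd l)) (Option.elim (Prod.snd (Prod.snd (Prod.snd l))) (Prod.fst (Prod.snd (Prod.snd l))) (fun _ => (0 : ℝ))) : Matrix (Fin 3) (Fin 3) ℝ) 0 2 = 0 ∧ (Matrix.transvection (Prod.fst l) (Prod.fst (Prod.snd l)) (Option.elim (Prod.snd (Prod.snd (Prod.snd l))) (Prod.fst (Prod.snd (Prod.snd l))) (fun _ => (0 : ℝ))) : Matrix (Fin 3) (Fin 3) ℝ) 1 2 = 0 ∧ (Matrix.transvection (Prod.fst l) (Prod.fst (Prod.snd l)) (Option.elim (Prod.snd (Prod.snd (Prod.snd l))) (Prod.fst (Prod.snd (Prod.snd l))) (fun _ => (0 : ℝ))) : Matrix (Fin 3) (Fin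 3) ℝ) 0 0 = 1 ∧ (Matrix.transvection (Prod.fst l) (Prod.fst (Prod.snd l)) (Option.elim (Prod.snd (Prod.snd (Prod.snd l))) (Prod.fst (Prod.snd (Prod.snd l))) (fun _ => (0 : ℝ))) : Matrix (Fin 3) (Fin 3) ℝ) 1 1 = 1 ∧
      (Matrix.transvection (Prod.fst l) (Prod.fst (Prod.snd l)) (Option.elim (Prod.snd (Prod.snd (Prod.snd l))) (Prod.fst (Prod.snd (Prod.snd l))) (fun _ => (0 : ℝ))) : Matrix (Fin 3) (Fin 3) ℝ) 2 2 = 1 := by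
  rcases k2_skel_cases l with h1 | ⟨ho, hc, h1⟩
  · rw [h1]; simp
  · rcases h with ⟨hpos, hadj⟩ | h0
    · rw [h1]
      rcases k2_adj_types l hadj with ⟨hi, hj⟩ | ⟨hi, hj⟩ | ⟨hi, hj⟩ | ⟨hi, hj⟩
      · exact absurd (hx1 ho hi hj) hc
      · exact absurd (hx2 ho hi hj) hc
      · rw [hi, hj]; exact k2_lowu_letter 1 0 (by decide) _
      · rw [hi, hj]; exact k2_lowu_letter 2 1 (by decide) _
    · exact absurd h0 hc

/-- Skeleton letters of a tame letter without constant positive `y₁`, `y₂` are `UPU`. [folklore] -/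
theorem k2_upu_skel {σ : Type} (l : Fin 3 × Fin 3 × ℝ × Option σ) (h : ((0 < Prod.fst (Prod.snd (Prod.snd l)) ∧ (Fin.val (Prod.fst l) + 1 = Fin.val (Prod.fst (Prod.snd l)) ∨ Fin.val (Prod.fst (Prod.snd l)) + 1 = Fin.val (Prod.fst l))) ∨ Prod.fst (Prod.snd (Prod.snd l)) = 0))
    (hy1 : l.2.2.2 = none → l.1 = 1 → l.2.1 = 0 → l.2.2.1 = 0)
    (hy2 : l.2.2.2 = none → l.1 = 2 → l.2.1 = 1 → l.2.2.1 = 0) :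
    (Matrix.transvection (Prod.fst l) (Prod.fst (Prod.snd l)) (Option.elim (Prod.snd (Prod.snd (Prod.snd l))) (Prod.fst (Prod.snd (Prod.snd l))) (fun _ => (0 : ℝ))) : Matrix (Fin 3) (Fin 3) ℝ) 1 0 = 0 ∧ (Matrix.transvection (Prod.fst l) (Prod.fst (Prod.snd l)) (Option.elim (Prod.snd (Prod.snd (Prod.snd l))) (Prod.fst (Prod.snd (Prod.snd l))) (fun _ => (0 : ℝ))) : Matrix (Fin 3) (Fin 3) ℝ) 2 0 = 0 ∧ (Matrix.transvection (Prod.fst l) (Prod.fst (Prod.snd l)) (Option.elim (Prod.snd (Prod.snd (Prod.snd l))) (Prod.fst (Prod.snd (Prod.snd l))) (fun _ => (0 : ℝ))) : Matrix (Fin 3) (Fin 3) ℝ) 2 1 = 0 ∧ (Matrix.transvection (Prod.fst l) (Prod.fst (Prod.snd l)) (Option.elim (Prod.snd (Prod.snd (Prod.snd l))) (Prod.fst (Prod.snd (Prod.snd l))) (fun _ => (0 : ℝ))) : Matrix (Fin 3) (Fin 3) ℝ) 0 0 = 1 ∧ (Matrix.transvection (Prod.fst l) (Prod.fst (Prod.snd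 l)) (Option.elim (Prod.snd (Prod.snd (Prod.snd l))) (Prod.fst (Prod.snd (Prod.snd l))) (fun _ => (0 : ℝ))) : Matrix (Fin 3) (Fin 3) ℝ) 1 1 = 1 ∧
      (Matrix.transvection (Prod.fst l) (Prod.fst (Prod.snd l)) (Option.elim (Prod.snd (Prod.snd (Prod.snd l))) (Prod.fst (Prod.snd (Prod.snd l))) (fun _ => (0 : ℝ))) : Matrix (Fin 3) (Fin 3) ℝ) 2 2 = 1 := by
  rcases k2_skel_cases l with h1 | ⟨ho, hc, h1⟩
  · rw [h1]; simp
  · rcases h with ⟨hpos, hadj⟩ | h0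
    · rw [h1]
      rcases k2_adj_types l hadj with ⟨hi, hj⟩ | ⟨hi, hj⟩ | ⟨hi, hj⟩ | ⟨hi, hj⟩
      · rw [hi, hj]; exact k2_upu_letter 0 1 (by decide) _
      · rw [hi, hj]; exact k2_upu_letter 1 2 (by decide) _
      · exact absurd (hy1 ho hi hj) hc
      · exact absurd (hy2 ho hi hj) hc
    · exact absurd h0 hc

/-- The common ROTATION of a skeleton loop `P̄₀ E₁(a) Q̄ E₂(b) P̄₂ = 1` with adjacent `E₁`, `E₂`
and tame `Q̄`: `S (P̄₂ P̄₀) S = E₂(b) Q̄ʳᵉᵛ E₁(a)`. [folklore] -/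
theorem k2_rotate {σ : Type} (q : List (Fin 3 × Fin 3 × ℝ × Option σ)) (hq : ∀ l ∈ q, ((0 < Prod.fst (Prod.snd (Prod.snd l)) ∧ (Fin.val (Prod.fst l) + 1 = Fin.val (Prod.fst (Prod.snd l)) ∨ Fin.val (Prod.fst (Prod.snd l)) + 1 = Fin.val (Prod.fst l))) ∨ Prod.fst (Prod.snd (Prod.snd l)) = 0))
    (i₁ j₁ i₂ j₂ : Fin 3) (h₁ : i₁.val + 1 = j₁.val ∨ j₁.val + 1 = i₁.val)
    (h₂ : i₂.val + 1 = j₂.val ∨ j₂.val + 1 = i₂.val) (a b : ℝ) (P0 P2 : Matrix (Fin 3) (Fin 3) ℝ)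
    (hloop : P0 * (Matrix.transvection i₁ j₁ a * ((q.map (fun l => (Matrix.transvection (Prod.fst l) (Prod.fst (Prod.snd l)) (Option.elim (Prod.snd (Prod.snd (Prod.snd l))) (Prod.fst (Prod.snd (Prod.snd l))) (fun _ => (0 : ℝ))) : Matrix (Fin 3) (Fin 3) ℝ))).prod *
      (Matrix.transvection i₂ j₂ b * P2))) = 1) :
    Matrix.diagonal ![(1 : ℝ), -1, 1] * (P2 * P0) * Matrix.diagonal ![(1 : ℝ), -1, 1] =
      Matrix.transvection i₂ j₂ b * (q.map (fun l => (Matrix.transvection (Prod.fst l) (Prod.fst (Prod.snd l)) (Option.elim (Prod.snd (Prod.snd (Prod.snd l))) (Prod.fst (Prod.snd (Prod.snd l))) (fun _ => (0 : ℝ))) : Matrix (Fin 3) (Fin 3) ℝ))).reverse.prod *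
        Matrix.transvection i₁ j₁ a := by
  have hi₁ : i₁ ≠ j₁ := by rintro rfl; omega
  have hi₂ : i₂ ≠ j₂ := by rintro rfl; omega
  set Qm : Matrix (Fin 3) (Fin 3) ℝ := (q.map (fun l => (Matrix.transvection (Prod.fst l) (Prod.fst (Prod.snd l)) (Option.elim (Prod.snd (Prod.snd (Prod.snd l))) (Prod.fst (Prod.snd (Prod.snd l))) (fun _ => (0 : ℝ))) : Matrix (Fin 3) (Fin 3) ℝ))).prod with hQm
  set R : Matrix (Fin 3) (Fin 3) ℝ := (q.map (fun l => (Matrix.transvection (Prod.fst l) (Prod.fst (Prod.snd l)) (Option.elim (Prod.snd (Prod.snd (Prod.snd l))) (Prod.fst (Prod.snd (Prod.snd l))) (fun _ => (0 : ℝ))) : Matrix (Fin 3) (Fin 3) ℝ))).reverse.prod with hR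
  set S : Matrix (Fin 3) (Fin 3) ℝ := Matrix.diagonal ![(1 : ℝ), -1, 1] with hSdef
  set X : Matrix (Fin 3) (Fin 3) ℝ := P2 * P0 with hX
  have hSS : S * S = 1 := k2_S_mul_S
  obtain ⟨-, hq2⟩ := k2_prod_mul_S_mul_rev S (q.map (fun l => (Matrix.transvection (Prod.fst l) (Prod.fst (Prod.snd l)) (Option.elim (Prod.snd (Prod.snd (Prod.snd l))) (Prod.fst (Prod.snd (Prod.snd l))) (fun _ => (0 : ℝ))) : Matrix (Fin 3) (Fin 3) ℝ))) (fun T hT => by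
    obtain ⟨l, hl, rfl⟩ := List.mem_map.1 hT
    exact k2r_tame_mul_S_mul l (hq l hl))
  have h1 : Matrix.transvection i₁ j₁ a * (Qm * (Matrix.transvection i₂ j₂ b * P2)) * P0 = 1 :=
    mul_eq_one_comm.mp hloop
  have h2 : Matrix.transvection i₁ j₁ a * (Qm * (Matrix.transvection i₂ j₂ b * X)) = 1 := by
    rw [hX]; simpa only [Matrix.mul_assoc] using h1
  have h3 : Qm * (Matrix.transvection i₂ j₂ b * X) = Matrix.transvection i₁ j₁ (-a) :=
    (k2_skel_inv_letter i₁ j₁ hi₁ a _).1 h2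
  have hinv : S * R * S * Qm = 1 := by
    calc S * R * S * Qm = S * (R * S * Qm) := by simp only [Matrix.mul_assoc]
      _ = 1 := by rw [hq2, hSS]
  have h4 : Matrix.transvection i₂ j₂ b * X = S * R * S * Matrix.transvection i₁ j₁ (-a) := by
    have := congrArg (fun Y => S * R * S * Y) h3
    simpa only [← Matrix.mul_assoc, hinv, Matrix.one_mul] using this
  have h5 : X = Matrix.transvection i₂ j₂ (-b) * (S * R * S * Matrix.transvection i₁ j₁ (-a)) := by
    rw [← h4, ← Matrix.mul_assoc, Matrix.transvection_mul_transvection_same _ _ hi₂]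
    simp
  rw [h5]
  calc S * (Matrix.transvection i₂ j₂ (-b) * (S * R * S * Matrix.transvection i₁ j₁ (-a))) * S
      = (S * Matrix.transvection i₂ j₂ (-b) * S) * R * (S * Matrix.transvection i₁ j₁ (-a) * S) := by
        simp only [Matrix.mul_assoc]
    _ = Matrix.transvection i₂ j₂ b * R * Matrix.transvection i₁ j₁ a := by
        rw [hSdef, k2_S_T_S, k2_S_T_S, if_pos h₁, if_pos h₂, neg_neg, neg_neg]

/-- Sign reading for the rotation: an entry `(i, j)` of `Q̄ʳᵉᵛ` untouched by `E₂(b)` (row `i₂`)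
and `E₁(a)` (column `j₁`) with `s_i s_j = -1` is `≤ 0` when `P̄₂ P̄₀ - 1 ≥ 0`. [folklore] -/
theorem k2_rotate_entry {σ : Type} (q : List (Fin 3 × Fin 3 × ℝ × Option σ))
    (i₁ j₁ i₂ j₂ : Fin 3) (a b : ℝ) (P0 P2 : Matrix (Fin 3) (Fin 3) ℝ)
    (hrot : Matrix.diagonal ![(1 : ℝ), -1, 1] * (P2 * P0) * Matrix.diagonal ![(1 : ℝ), -1, 1] =
      Matrix.transvection i₂ j₂ b * (q.map (fun l => (Matrix.transvection (Prod.fst l) (Prod.fst (Prod.snd l)) (Option.elim (Prod.snd (Prod.snd (Prod.snd l))) (Prod.fst (Prod.snd (Prod.snd l))) (fun _ => (0 : ℝ))) : Matrix (Fin 3) (Fin 3) ℝ))).reverse.prod *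
        Matrix.transvection i₁ j₁ a)
    (hX : ∀ i j, 0 ≤ (P2 * P0 - 1) i j) (i j : Fin 3) (hij : i ≠ j) (hi : i ≠ i₂) (hj : j ≠ j₁)
    (hs : ![(1 : ℝ), -1, 1] i * ![(1 : ℝ), -1, 1] j = -1) :
    (q.map (fun l => (Matrix.transvection (Prod.fst l) (Prod.fst (Prod.snd l)) (Option.elim (Prod.snd (Prod.snd (Prod.snd l))) (Prod.fst (Prod.snd (Prod.snd l))) (fun _ => (0 : ℝ))) : Matrix (Fin 3) (Fin 3) ℝ))).reverse.prod i j ≤ 0 := by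
  have e : (Matrix.diagonal ![(1 : ℝ), -1, 1] * (P2 * P0) * Matrix.diagonal ![(1 : ℝ), -1, 1]) i j =
      (q.map (fun l => (Matrix.transvection (Prod.fst l) (Prod.fst (Prod.snd l)) (Option.elim (Prod.snd (Prod.snd (Prod.snd l))) (Prod.fst (Prod.snd (Prod.snd l))) (fun _ => (0 : ℝ))) : Matrix (Fin 3) (Fin 3) ℝ))).reverse.prod i j := by
    rw [hrot, Matrix.mul_transvection_apply_of_ne _ _ _ _ hj,
      Matrix.transvection_mul_apply_of_ne _ _ _ _ hi]
  rw [k2_SXS_apply] at e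
  have h0 := hX i j
  rw [Matrix.sub_apply, Matrix.one_apply_ne hij, sub_zero] at h0
  have : ![(1 : ℝ), -1, 1] i * (P2 * P0) i j * ![(1 : ℝ), -1, 1] j = -((P2 * P0) i j) := by
    rw [mul_comm _ ((P2 * P0) i j), mul_assoc, hs]; ring
  linarith


/-- **Confinement, family `(y₁,y₂)`.** [folklore] -/
theorem k2_conf_III {σ : Type} (p0 q p2 : List (Fin 3 × Fin 3 × ℝ × Option σ)) (a b : ℝ)
    (ht : ∀ l ∈ p0 ++ q ++ p2, ((0 < Prod.fst (Prod.snd (Prod.snd l)) ∧ (Fin.val (Prod.fst l) + 1 = Fin.val (Prod.fst (Prod.snd l)) ∨ Fin.val (Prod.fst (Prod.snd l)) + 1 = Fin.val (Prod.fst l))) ∨ Prod.fst (Prod.snd (Prod.snd l)) = 0))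
    (hloop : (p0.map (fun l => (Matrix.transvection (Prod.fst l) (Prod.fst (Prod.snd l)) (Option.elim (Prod.snd (Prod.snd (Prod.snd l))) (Prod.fst (Prod.snd (Prod.snd l))) (fun _ => (0 : ℝ))) : Matrix (Fin 3) (Fin 3) ℝ))).prod * (Matrix.transvection 1 0 a *
      ((q.map (fun l => (Matrix.transvection (Prod.fst l) (Prod.fst (Prod.snd l)) (Option.elim (Prod.snd (Prod.snd (Prod.snd l))) (Prod.fst (Prod.snd (Prod.snd l))) (fun _ => (0 : ℝ))) : Matrix (Fin 3) (Fin 3) ℝ))).prod * (Matrix.transvection 2 1 b * (p2.map (fun l => (Matrix.transvection (Prod.fst l) (Prod.fst (Prod.snd l)) (Option.elim (Prod.snd (Prod.snd (Prod.snd l))) (Prod.fst (Prod.snd (Prod.snd l))) (fun _ => (0 : ℝ))) : Matrix (Fin 3) (Fin 3) ℝ))).prod))) = 1) :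
    ∀ l ∈ p0 ++ q ++ p2, l.2.2.2 = none →
      (l.1 = 0 → l.2.1 = 1 → l.2.2.1 = 0) ∧ (l.1 = 1 → l.2.1 = 2 → l.2.2.1 = 0) := by
  have hp0 : ∀ l ∈ p0, ((0 < Prod.fst (Prod.snd (Prod.snd l)) ∧ (Fin.val (Prod.fst l) + 1 = Fin.val (Prod.fst (Prod.snd l)) ∨ Fin.val (Prod.fst (Prod.snd l)) + 1 = Fin.val (Prod.fst l))) ∨ Prod.fst (Prod.snd (Prod.snd l)) = 0) := fun l hl => ht l (by simp [hl])
  have hq : ∀ l ∈ q, ((0 < Prod.fst (Prod.snd (Prod.snd l)) ∧ (Fin.val (Prod.fst l) + 1 = Fin.val (Prod.fst (Prod.snd l)) ∨ Fin.val (Prod.fst (Prod.snd l)) + 1 = Fin.val (Prod.fst l))) ∨ Prod.fst (Prod.snd (Prod.snd l)) = 0) := fun l hl => ht l (by simp [hl])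
  have hp2 : ∀ l ∈ p2, ((0 < Prod.fst (Prod.snd (Prod.snd l)) ∧ (Fin.val (Prod.fst l) + 1 = Fin.val (Prod.fst (Prod.snd l)) ∨ Fin.val (Prod.fst (Prod.snd l)) + 1 = Fin.val (Prod.fst l))) ∨ Prod.fst (Prod.snd (Prod.snd l)) = 0) := fun l hl => ht l (by simp [hl])
  set P0 : Matrix (Fin 3) (Fin 3) ℝ := (p0.map (fun l => (Matrix.transvection (Prod.fst l) (Prod.fst (Prod.snd l)) (Option.elim (Prod.snd (Prod.snd (Prod.snd l))) (Prod.fst (Prod.snd (Prod.snd l))) (fun _ => (0 : ℝ))) : Matrix (Fin 3) (Fin 3) ℝ))).prod with hP0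
  set P2 : Matrix (Fin 3) (Fin 3) ℝ := (p2.map (fun l => (Matrix.transvection (Prod.fst l) (Prod.fst (Prod.snd l)) (Option.elim (Prod.snd (Prod.snd (Prod.snd l))) (Prod.fst (Prod.snd (Prod.snd l))) (fun _ => (0 : ℝ))) : Matrix (Fin 3) (Fin 3) ℝ))).prod with hP2
  set R : Matrix (Fin 3) (Fin 3) ℝ := (q.map (fun l => (Matrix.transvection (Prod.fst l) (Prod.fst (Prod.snd l)) (Option.elim (Prod.snd (Prod.snd (Prod.snd l))) (Prod.fst (Prod.snd (Prod.snd l))) (fun _ => (0 : ℝ))) : Matrix (Fin 3) (Fin 3) ℝ))).reverse.prod with hR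
  have hrot := k2_rotate q hq 1 0 2 1 (by decide) (by decide) a b P0 P2 hloop
  have hX' : P2 * P0 = ((p2 ++ p0).map (fun l => (Matrix.transvection (Prod.fst l) (Prod.fst (Prod.snd l)) (Option.elim (Prod.snd (Prod.snd (Prod.snd l))) (Prod.fst (Prod.snd (Prod.snd l))) (fun _ => (0 : ℝ))) : Matrix (Fin 3) (Fin 3) ℝ))).prod := by
    rw [hP2, hP0, List.map_append, List.prod_append]
  have ht20 : ∀ l ∈ p2 ++ p0, ((0 < Prod.fst (Prod.snd (Prod.snd l)) ∧ (Fin.val (Prod.fst l) + 1 = Fin.val (Prod.fst (Prod.snd l)) ∨ Fin.val (Prod.fst (Prod.snd l)) + 1 = Fin.val (Prod.fst l))) ∨ Prod.fst (Prod.snd (Prod.snd l)) = 0) := fun l hl => by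
    rcases List.mem_append.1 hl with h | h
    · exact hp2 l h
    · exact hp0 l h
  have hXnn : ∀ i j, 0 ≤ (P2 * P0 - 1) i j := by
    rw [hX']
    refine k2r_prod_sub_one_nonneg _ fun T hT => ?_
    obtain ⟨l, hl, rfl⟩ := List.mem_map.1 hT
    exact k2r_tame_sub_one_nonneg l (ht20 l hl)
  have hR01 : R 0 1 ≤ 0 := k2_rotate_entry q 1 0 2 1 a b P0 P2 hrot hXnn 0 1 (by decide) (by decide)
    (by decide) (by simp)
  have hR12 : R 1 2 ≤ 0 := k2_rotate_entry q 1 0 2 1 a b P0 P2 hrot hXnn 1 2 (by decide) (by decide)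
    (by decide) (by simp)
  have hRrev : R = (q.reverse.map (fun l => (Matrix.transvection (Prod.fst l) (Prod.fst (Prod.snd l)) (Option.elim (Prod.snd (Prod.snd (Prod.snd l))) (Prod.fst (Prod.snd (Prod.snd l))) (fun _ => (0 : ℝ))) : Matrix (Fin 3) (Fin 3) ℝ))).prod := by rw [hR, List.map_reverse]
  have hqrev : ∀ l ∈ q.reverse, ((0 < Prod.fst (Prod.snd (Prod.snd l)) ∧ (Fin.val (Prod.fst l) + 1 = Fin.val (Prod.fst (Prod.snd l)) ∨ Fin.val (Prod.fst (Prod.snd l)) + 1 = Fin.val (Prod.fst l))) ∨ Prod.fst (Prod.snd (Prod.snd l)) = 0) := fun l hl => hq l (List.mem_reverse.1 hl)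
  have qx1 := k2r_no_const_letter q.reverse hqrev 0 1 (by decide) (by rw [← hRrev]; exact hR01)
  have qx2 := k2r_no_const_letter q.reverse hqrev 1 2 (by decide) (by rw [← hRrev]; exact hR12)
  have hRlow : R 0 1 = 0 ∧ R 0 2 = 0 ∧ R 1 2 = 0 ∧ R 0 0 = 1 ∧ R 1 1 = 1 ∧ R 2 2 = 1 := by
    rw [hR]
    refine k2_lowu_prod _ fun G hG => ?_
    rw [List.mem_reverse] at hG
    obtain ⟨l, hl, rfl⟩ := List.mem_map.1 hG
    exact k2_lowu_skel l (hq l hl) (fun ho hi hj => qx1 l (List.mem_reverse.2 hl) ho hi hj)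
      (fun ho hi hj => qx2 l (List.mem_reverse.2 hl) ho hi hj)
  have hSXS := k2_lowu_mul _ _ (k2_lowu_mul _ _ (k2_lowu_letter 2 1 (by decide) b) hRlow)
    (k2_lowu_letter 1 0 (by decide) a)
  rw [← hrot] at hSXS
  have x01 : (P2 * P0) 0 1 = 0 := by
    have := hSXS.1; rw [k2_SXS_apply] at this; simpa using this
  have x12 : (P2 * P0) 1 2 = 0 := by
    have := hSXS.2.2.1; rw [k2_SXS_apply] at this; simpa using this
  have px1 := k2r_no_const_letter (p2 ++ p0) ht20 0 1 (by decide) (by rw [← hX']; exact x01.le)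
  have px2 := k2r_no_const_letter (p2 ++ p0) ht20 1 2 (by decide) (by rw [← hX']; exact x12.le)
  intro l hl ho
  simp only [List.mem_append] at hl
  rcases hl with (h | h) | h
  · exact ⟨px1 l (by simp [h]) ho, px2 l (by simp [h]) ho⟩
  · exact ⟨qx1 l (List.mem_reverse.2 h) ho, qx2 l (List.mem_reverse.2 h) ho⟩
  · exact ⟨px1 l (by simp [h]) ho, px2 l (by simp [h]) ho⟩

/-- **Confinement, family `(x₂,x₁)`.** [folklore] -/
theorem k2_conf_IV {σ : Type} (p0 q p2 : List (Fin 3 × Fin 3 × ℝ × Option σ)) (a b : ℝ)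
    (ht : ∀ l ∈ p0 ++ q ++ p2, ((0 < Prod.fst (Prod.snd (Prod.snd l)) ∧ (Fin.val (Prod.fst l) + 1 = Fin.val (Prod.fst (Prod.snd l)) ∨ Fin.val (Prod.fst (Prod.snd l)) + 1 = Fin.val (Prod.fst l))) ∨ Prod.fst (Prod.snd (Prod.snd l)) = 0))
    (hloop : (p0.map (fun l => (Matrix.transvection (Prod.fst l) (Prod.fst (Prod.snd l)) (Option.elim (Prod.snd (Prod.snd (Prod.snd l))) (Prod.fst (Prod.snd (Prod.snd l))) (fun _ => (0 : ℝ))) : Matrix (Fin 3) (Fin 3) ℝ))).prod * (Matrix.transvection 1 2 a *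
      ((q.map (fun l => (Matrix.transvection (Prod.fst l) (Prod.fst (Prod.snd l)) (Option.elim (Prod.snd (Prod.snd (Prod.snd l))) (Prod.fst (Prod.snd (Prod.snd l))) (fun _ => (0 : ℝ))) : Matrix (Fin 3) (Fin 3) ℝ))).prod * (Matrix.transvection 0 1 b * (p2.map (fun l => (Matrix.transvection (Prod.fst l) (Prod.fst (Prod.snd l)) (Option.elim (Prod.snd (Prod.snd (Prod.snd l))) (Prod.fst (Prod.snd (Prod.snd l))) (fun _ => (0 : ℝ))) : Matrix (Fin 3) (Fin 3) ℝ))).prod))) = 1) :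
    ∀ l ∈ p0 ++ q ++ p2, l.2.2.2 = none →
      (l.1 = 1 → l.2.1 = 0 → l.2.2.1 = 0) ∧ (l.1 = 2 → l.2.1 = 1 → l.2.2.1 = 0) := by
  have hp0 : ∀ l ∈ p0, ((0 < Prod.fst (Prod.snd (Prod.snd l)) ∧ (Fin.val (Prod.fst l) + 1 = Fin.val (Prod.fst (Prod.snd l)) ∨ Fin.val (Prod.fst (Prod.snd l)) + 1 = Fin.val (Prod.fst l))) ∨ Prod.fst (Prod.snd (Prod.snd l)) = 0) := fun l hl => ht l (by simp [hl])
  have hq : ∀ l ∈ q, ((0 < Prod.fst (Prod.snd (Prod.snd l)) ∧ (Fin.val (Prod.fst l) + 1 = Fin.val (Prod.fst (Prod.snd l)) ∨ Fin.val (Prod.fst (Prod.snd l)) + 1 = Fin.val (Prod.fst l))) ∨ Prod.fst (Prod.snd (Prod.snd l)) = 0) := fun l hl => ht l (by simp [hl])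
  have hp2 : ∀ l ∈ p2, ((0 < Prod.fst (Prod.snd (Prod.snd l)) ∧ (Fin.val (Prod.fst l) + 1 = Fin.val (Prod.fst (Prod.snd l)) ∨ Fin.val (Prod.fst (Prod.snd l)) + 1 = Fin.val (Prod.fst l))) ∨ Prod.fst (Prod.snd (Prod.snd l)) = 0) := fun l hl => ht l (by simp [hl])
  set P0 : Matrix (Fin 3) (Fin 3) ℝ := (p0.map (fun l => (Matrix.transvection (Prod.fst l) (Prod.fst (Prod.snd l)) (Option.elim (Prod.snd (Prod.snd (Prod.snd l))) (Prod.fst (Prod.snd (Prod.snd l))) (fun _ => (0 : ℝ))) : Matrix (Fin 3) (Fin 3) ℝ))).prod with hP0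
  set P2 : Matrix (Fin 3) (Fin 3) ℝ := (p2.map (fun l => (Matrix.transvection (Prod.fst l) (Prod.fst (Prod.snd l)) (Option.elim (Prod.snd (Prod.snd (Prod.snd l))) (Prod.fst (Prod.snd (Prod.snd l))) (fun _ => (0 : ℝ))) : Matrix (Fin 3) (Fin 3) ℝ))).prod with hP2
  set R : Matrix (Fin 3) (Fin 3) ℝ := (q.map (fun l => (Matrix.transvection (Prod.fst l) (Prod.fst (Prod.snd l)) (Option.elim (Prod.snd (Prod.snd (Prod.snd l))) (Prod.fst (Prod.snd (Prod.snd l))) (fun _ => (0 : ℝ))) : Matrix (Fin 3) (Fin 3) ℝ))).reverse.prod with hR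
  have hrot := k2_rotate q hq 1 2 0 1 (by decide) (by decide) a b P0 P2 hloop
  have hX' : P2 * P0 = ((p2 ++ p0).map (fun l => (Matrix.transvection (Prod.fst l) (Prod.fst (Prod.snd l)) (Option.elim (Prod.snd (Prod.snd (Prod.snd l))) (Prod.fst (Prod.snd (Prod.snd l))) (fun _ => (0 : ℝ))) : Matrix (Fin 3) (Fin 3) ℝ))).prod := by
    rw [hP2, hP0, List.map_append, List.prod_append]
  have ht20 : ∀ l ∈ p2 ++ p0, ((0 < Prod.fst (Prod.snd (Prod.snd l)) ∧ (Fin.val (Prod.fst l) + 1 = Fin.val (Prod.fst (Prod.snd l)) ∨ Fin.val (Prod.fst (Prod.snd l)) + 1 = Fin.val (Prod.fst l))) ∨ Prod.fst (Prod.snd (Prod.snd l)) = 0) := fun l hl => by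
    rcases List.mem_append.1 hl with h | h
    · exact hp2 l h
    · exact hp0 l h
  have hXnn : ∀ i j, 0 ≤ (P2 * P0 - 1) i j := by
    rw [hX']
    refine k2r_prod_sub_one_nonneg _ fun T hT => ?_
    obtain ⟨l, hl, rfl⟩ := List.mem_map.1 hT
    exact k2r_tame_sub_one_nonneg l (ht20 l hl)
  have hR10 : R 1 0 ≤ 0 := k2_rotate_entry q 1 2 0 1 a b P0 P2 hrot hXnn 1 0 (by decide) (by decide)
    (by decide) (by simp)
  have hR21 : R 2 1 ≤ 0 := k2_rotate_entry q 1 2 0 1 a b P0 P2 hrot hXnn 2 1 (by decide) (by decide)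
    (by decide) (by simp)
  have hRrev : R = (q.reverse.map (fun l => (Matrix.transvection (Prod.fst l) (Prod.fst (Prod.snd l)) (Option.elim (Prod.snd (Prod.snd (Prod.snd l))) (Prod.fst (Prod.snd (Prod.snd l))) (fun _ => (0 : ℝ))) : Matrix (Fin 3) (Fin 3) ℝ))).prod := by rw [hR, List.map_reverse]
  have hqrev : ∀ l ∈ q.reverse, ((0 < Prod.fst (Prod.snd (Prod.snd l)) ∧ (Fin.val (Prod.fst l) + 1 = Fin.val (Prod.fst (Prod.snd l)) ∨ Fin.val (Prod.fst (Prod.snd l)) + 1 = Fin.val (Prod.fst l))) ∨ Prod.fst (Prod.snd (Prod.snd l)) = 0) := fun l hl => hq l (List.mem_reverse.1 hl)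
  have qy1 := k2r_no_const_letter q.reverse hqrev 1 0 (by decide) (by rw [← hRrev]; exact hR10)
  have qy2 := k2r_no_const_letter q.reverse hqrev 2 1 (by decide) (by rw [← hRrev]; exact hR21)
  have hRup : R 1 0 = 0 ∧ R 2 0 = 0 ∧ R 2 1 = 0 ∧ R 0 0 = 1 ∧ R 1 1 = 1 ∧ R 2 2 = 1 := by
    rw [hR]
    refine k2_upu_prod _ fun G hG => ?_
    rw [List.mem_reverse] at hG
    obtain ⟨l, hl, rfl⟩ := List.mem_map.1 hG
    exact k2_upu_skel l (hq l hl) (fun ho hi hj => qy1 l (List.mem_reverse.2 hl) ho hi hj)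
      (fun ho hi hj => qy2 l (List.mem_reverse.2 hl) ho hi hj)
  have hSXS := k2_upu_mul _ _ (k2_upu_mul _ _ (k2_upu_letter 0 1 (by decide) b) hRup)
    (k2_upu_letter 1 2 (by decide) a)
  rw [← hrot] at hSXS
  have x10 : (P2 * P0) 1 0 = 0 := by
    have := hSXS.1; rw [k2_SXS_apply] at this; simpa using this
  have x21 : (P2 * P0) 2 1 = 0 := by
    have := hSXS.2.2.1; rw [k2_SXS_apply] at this; simpa using this
  have py1 := k2r_no_const_letter (p2 ++ p0) ht20 1 0 (by decide) (by rw [← hX']; exact x10.le)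
  have py2 := k2r_no_const_letter (p2 ++ p0) ht20 2 1 (by decide) (by rw [← hX']; exact x21.le)
  intro l hl ho
  simp only [List.mem_append] at hl
  rcases hl with (h | h) | h
  · exact ⟨py1 l (by simp [h]) ho, py2 l (by simp [h]) ho⟩
  · exact ⟨qy1 l (List.mem_reverse.2 h) ho, qy2 l (List.mem_reverse.2 h) ho⟩
  · exact ⟨py1 l (by simp [h]) ho, py2 l (by simp [h]) ho⟩

end Summit.ValiantsHypothesis.ValiantsHypothesis.Cruxes.WordLengthQP.PositiveMonoidExits

end
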